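import Literature.Geometry.Kaehler.RiemannSurfaceSubgroupCovering
import Literature.Geometry.Kaehler.RiemannSurfaceDegreeComp
import Literature.AlgebraicTopology.FundamentalGroup.MapOfEqRange
import HarnessLib

/-!
# A non-constant holomorphic map of compact Riemann surfaces has image of finite index on `π₁`, dividing its degree: the maximal unramified factorisation (Hatcher 1.33 + 1.36)

Layer `Literature/Geometry/Kaehler`, sequel WITHOUT definitions of `RiemannSurfaceSubgroupCovering` (Hatcher 1.36 +
1.32: the covering `q : Y → N` of an arbitrary subgroup `H ≤ π₁(N, y)` with `q_* π₁(Y) = H` and `[π₁ : H]` points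
in every fibre; the pulled-back complex structure, Forster 4.6), of Mathlib's lifting criterion (Hatcher Prop. 1.33,
`IsCoveringMap.existsUnique_continuousMap_lifts_of_range_le`), of `RiemannSurfaceOpenMapping` (Farkas–Kra I.1.5:
a non-constant holomorphic map from a compact surface is onto and its target is compact) and of
`RiemannSurfaceDegree` ∕ `RiemannSurfaceDegreeComp` (Farkas–Kra I.1.6: the degree; `deg (g ∘ f) = deg g · deg f`).

A. Hatcher, *Algebraic Topology* (2002), §1.3 Prop. 1.33 (p. 61, the lifting criterion: a map `f : Y → X` from a
path connected, locally path connected `Y` lifts to the covering `p : X̃ → X` iff `f_* π₁(Y) ⊆ p_* π₁(X̃)`),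
Prop. 1.36 (p. 68), Prop. 1.32 (number of sheets `=` index).  H. M. Farkas, I. Kra, *Riemann Surfaces* (1992),
I.1.5–I.1.6.  Assembled: for `F : M → N` non-constant holomorphic between compact connected Riemann surfaces and
`H = F_* π₁(M, x₀) ≤ π₁(N, F x₀)`, the covering `q : Y_H → N` receives a continuous lift `F̃ : M → Y_H` of `F`,
holomorphic for the pulled-back structure and non-constant, hence onto; so `Y_H` is compact, `q` has finitely many
— namely `[π₁(N) : H]` — sheets, and `deg F = deg F̃ · [π₁(N, F x₀) : F_* π₁(M, x₀)]`.

## What is proved (everything; no definitions, no instances, no named facts)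

* `mdifferentiable_of_comp_eq` — a continuous map `G : M → Y` over a holomorphic local biholomorphism
  `q : Y → N` with `q ∘ G` holomorphic is holomorphic (Forster 4.6-type);
* **`exists_etale_factorisation`** ∕ **`exists_unramified_factorisation`** — the factorisation `F = q ∘ F̃` through the compact Riemann surface
  `Y = Ñ ×_{π₁} (π₁ ⧸ H)` of `H = F_* π₁(M, x₀)`: `q` a holomorphic covering with `[π₁(N) : H]` sheets, `F̃`
  holomorphic, onto, with `F̃_* π₁(M, x₀) = π₁(Y, F̃ x₀)` (the étale form records that `q` is a local biholomorphism
  for the structure of `Y`, so that maps into `Y` over `N` are holomorphic by rigidity);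
* **`finiteIndex_range_map`** ∕ `index_range_map_ne_zero` — `F_* π₁(M, x₀)` has finite index in `π₁(N, F x₀)`;
* **`index_range_map_dvd_degree`** — `[π₁(N, F x₀) : F_* π₁(M, x₀)]` divides `deg F` (the total multiplicity of
  any fibre), in particular `index_range_map_le_degree`;
* corollaries: `index_range_map_eq_one_or_eq_of_prime_degree` (prime degree: `F_*` onto, or index `= p`),
  **`isCoveringMap_of_index_eq_degree`** (index `= deg F` forces `F` to be an unramified covering map: the factor
  `F̃` has degree `1`), `index_range_map_eq_one_of_prime_of_ramified` ∕ `surjective_map_of_prime_of_ramified`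
  (a ramified map of prime degree is onto on `π₁`), `finite_fundamentalGroup_of_simplyConnectedSpace` ∕
  `arithGenus_eq_zero_of_simplyConnectedSpace` (a compact surface dominated by a simply connected one has finite,
  hence trivial, `π₁`: genus `0`).

## References

* A. Hatcher, *Algebraic Topology*, Cambridge University Press (2002), §1.3 Prop. 1.32, 1.33 (p. 61), Prop. 1.36
  (p. 68). [HatcherAT2002]
* H. M. Farkas, I. Kra, *Riemann Surfaces*, GTM 71, 2nd ed., Springer (1992), I.1.5, I.1.6, I.2.7. [FarkasKra1992]
* O. Forster, *Lectures on Riemann Surfaces*, GTM 81, Springer (1981), §4 Thm. 4.6. [Forster1981]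
-/

noncomputable section

open Set Function TopologicalSpace
open _root_.Topology
open scoped Manifold ContDiff

namespace Literature.Geometry.Kaehler

open Literature.Topology.CoveringSpaces

namespace RiemannSurface

universe u v

/-! ### §1 Lifts over a holomorphic local biholomorphism are holomorphic -/

/-- **A continuous map over a holomorphic local biholomorphism is holomorphic**: if `q : Y → N` is a local
`C^ω`-diffeomorphism of spaces charted over `ℂ`, `G : M → Y` is continuous and `q ∘ G` is holomorphic, then `G` is
holomorphic — near each point `G = Φ⁻¹ ∘ (q ∘ G)` for the local inverse `Φ⁻¹` of `q` at `G x`.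
[cite: Forster1981, §4 Thm. 4.6] -/
theorem mdifferentiable_of_comp_eq {M : Type*} [TopologicalSpace M] [ChartedSpace ℂ M]
    {N : Type*} [TopologicalSpace N] [ChartedSpace ℂ N] {Y : Type*} [TopologicalSpace Y] [ChartedSpace ℂ Y]
    {q : Y → N} (hq : IsLocalDiffeomorph 𝓘(ℂ, ℂ) 𝓘(ℂ, ℂ) ω q) {G : M → Y} (hGc : Continuous G)
    {F : M → N} (hF : MDifferentiable 𝓘(ℂ, ℂ) 𝓘(ℂ, ℂ) F) (hGF : ∀ x, q (G x) = F x) :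
    MDifferentiable 𝓘(ℂ, ℂ) 𝓘(ℂ, ℂ) G := by
  intro x
  obtain ⟨Φ, hxΦ, heq⟩ := hq (G x)
  have hnear : ∀ᶠ w in 𝓝 x, G w ∈ Φ.source :=
    hGc.continuousAt.preimage_mem_nhds (Φ.open_source.mem_nhds hxΦ)
  have hloc : (Φ.symm ∘ F) =ᶠ[𝓝 x] G := by
    filter_upwards [hnear] with w hw
    simp only [Function.comp_apply]
    rw [← hGF w, heq hw]
    exact Φ.toPartialEquiv.left_inv hw
  have hsymm : MDifferentiableAt 𝓘(ℂ, ℂ) 𝓘(ℂ, ℂ) Φ.symm (F x) := by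
    have hmem : F x ∈ Φ.symm.source := by
      rw [← hGF x, heq hxΦ]
      exact Φ.toPartialEquiv.map_source hxΦ
    exact Φ.symm.mdifferentiableAt (by simp) hmem
  exact (hsymm.comp x (hF x)).congr_of_eventuallyEq hloc.symm

/-- `FundamentalGroup.mapOfEq` only depends on the underlying continuous map. [cite: HatcherAT2002, §1.1 (induced homomorphism)] -/
private theorem mapOfEq_congr_fun {A : Type*} {B : Type*} [TopologicalSpace A] [TopologicalSpace B]
    {f₁ f₂ : C(A, B)} (h : f₁ = f₂) {a : A} {b : B} (h₁ : f₁ a = b) (h₂ : f₂ a = b) (γ : FundamentalGroup A a) :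
    FundamentalGroup.mapOfEq f₁ h₁ γ = FundamentalGroup.mapOfEq f₂ h₂ γ := by
  subst h
  rfl

/-! ### §2 The maximal unramified factorisation of a non-constant holomorphic map -/

variable {M : Type u} [TopologicalSpace M] [ChartedSpace ℂ M] [ConnectedSpace M] [IsManifold 𝓘(ℂ, ℂ) ω M]
  [CompactSpace M] [T2Space M]
  {N : Type v} [TopologicalSpace N] [ChartedSpace ℂ N] [ConnectedSpace N] [IsManifold 𝓘(ℂ, ℂ) ω N]
  [CompactSpace N] [T2Space N]
  {F : M → N}

omit [T2Space M] [CompactSpace N] in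
/-- **The maximal unramified factorisation `F = q ∘ F̃`, étale form** (the covering `q` is moreover a local
biholomorphism for the structure of `Y`, which is the one pulled back along `q` — so that continuous maps into
`Y` over `N` from Riemann surfaces are holomorphic, `RiemannSurfaceStructurePullbackRigidity`): see
`exists_unramified_factorisation` for the description. [cite: HatcherAT2002, §1.3 Prop. 1.33 (p. 61), Prop. 1.36 (p. 68)]
[cite: Forster1981, §4 Thm. 4.6] [cite: FarkasKra1992, I.1.5 Theorem] -/
theorem exists_etale_factorisation (hF : MDifferentiable 𝓘(ℂ, ℂ) 𝓘(ℂ, ℂ) F) (hne : ∃ a b, F a ≠ F b)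
    (x₀ : M) :
    ∃ (Y : Type v) (_ : TopologicalSpace Y) (_ : ChartedSpace ℂ Y) (_ : IsManifold 𝓘(ℂ, ℂ) ω Y)
      (_ : CompactSpace Y) (_ : T2Space Y) (_ : ConnectedSpace Y) (q : Y → N) (hq : IsCoveringMap q)
      (Ft : C(M, Y)) (hx₀ : q (Ft x₀) = F x₀),
      MDifferentiable 𝓘(ℂ, ℂ) 𝓘(ℂ, ℂ) q ∧ MDifferentiable 𝓘(ℂ, ℂ) 𝓘(ℂ, ℂ) Ft ∧ Surjective Ft ∧
        (∀ x, q (Ft x) = F x) ∧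
        (∀ y, (q ⁻¹' {y}).ncard = (FundamentalGroup.map (⟨F, hF.continuous⟩ : C(M, N)) x₀).range.index) ∧
        (FundamentalGroup.mapOfEq (⟨q, hq.continuous⟩ : C(Y, N)) hx₀).range =
          (FundamentalGroup.map (⟨F, hF.continuous⟩ : C(M, N)) x₀).range ∧
        (FundamentalGroup.map Ft x₀).range = ⊤ ∧ IsLocalDiffeomorph 𝓘(ℂ, ℂ) 𝓘(ℂ, ℂ) ω q := by
  haveI := pathConnectedSpace_of_connectedSpace N
  haveI := stronglyLocallyContractibleSpace_of_riemannSurface N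
  haveI := pathConnectedSpace_of_connectedSpace M
  haveI := ChartedSpace.locallyPathConnectedSpace ℂ M
  set f : C(M, N) := ⟨F, hF.continuous⟩ with hf
  set H := (FundamentalGroup.map f x₀).range with hH
  obtain ⟨Y, _, q, hq, y₀, hy₀, hY, hrange, hcard⟩ :=
    UniversalCover.exists_covering_of_subgroup_index (X := N) (x₀ := F x₀) H
  -- the lift `F̃` of `F` (Hatcher 1.33)
  obtain ⟨Ft, ⟨hFt0, hFtq⟩, -⟩ :=
    hq.existsUnique_continuousMap_lifts_of_range_le (f := f) (a₀ := x₀) (e₀ := y₀) hy₀ hrange.symm.le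
  have hqFt : ∀ x, q (Ft x) = F x := fun x ↦ congrFun hFtq x
  -- the complex structure on `Y`
  letI := IsLocalHomeomorph.comapChartedSpace ℂ hq.isLocalHomeomorph
  haveI : IsManifold 𝓘(ℂ, ℂ) ω Y := (riemannSurface_of_isCoveringMap hq).1
  haveI : T2Space Y := hq.t2Space
  have hqd : MDifferentiable 𝓘(ℂ, ℂ) 𝓘(ℂ, ℂ) q := (riemannSurface_of_isCoveringMap hq).2.1
  have hFtd : MDifferentiable 𝓘(ℂ, ℂ) 𝓘(ℂ, ℂ) Ft :=
    mdifferentiable_of_comp_eq (riemannSurface_of_isCoveringMap hq).2.2 Ft.continuous hF hqFt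
  -- `F̃` is non-constant, hence onto, and `Y` is compact
  have hFtne : ∃ a b, Ft a ≠ Ft b := by
    obtain ⟨a, b, hab⟩ := hne
    exact ⟨a, b, fun h ↦ hab (by rw [← hqFt a, ← hqFt b, h])⟩
  have hFts : Surjective Ft := surjective_of_exists_ne hFtd hFtne
  haveI : CompactSpace Y := compactSpace_of_exists_ne hFtd hFtne
  have hx₀ : q (Ft x₀) = F x₀ := by rw [hFt0]; exact hy₀
  refine ⟨Y, inferInstance, inferInstance, inferInstance, inferInstance, inferInstance, inferInstance, q, hq, Ft, hx₀,
    hqd, hFtd, hFts, hqFt, fun y ↦ hcard y, ?_, ?_, (riemannSurface_of_isCoveringMap hq).2.2⟩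
  · -- `q_* π₁(Y, F̃ x₀) = H` (transport of `hrange` along `F̃ x₀ = y₀`)
    subst hFt0
    exact hrange
  · -- `F̃_*` is onto: `q_* ∘ F̃_* = F_*`, `q_*` injective with image `H = F_* π₁(M)`
    subst hFt0
    rw [eq_top_iff]
    rintro δ -
    have hδ : FundamentalGroup.mapOfEq (⟨q, hq.continuous⟩ : C(Y, N)) hy₀ δ ∈ H := hrange ▸ ⟨δ, rfl⟩
    obtain ⟨γ, hγ⟩ := hδ
    refine ⟨γ, Literature.AlgebraicTopology.FundamentalGroup.mapOfEq_injective_of_isCoveringMap hq ⟨Ft x₀, hy₀⟩ ?_⟩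
    -- `q_* (F̃_* γ) = (q ∘ F̃)_* γ = F_* γ`
    have hcomp : (⟨q, hq.continuous⟩ : C(Y, N)).comp Ft = f := ContinuousMap.ext hqFt
    rw [← hγ, ← Literature.AlgebraicTopology.FundamentalGroup.mapOfEq_rfl_apply Ft,
      ← Literature.AlgebraicTopology.FundamentalGroup.mapOfEq_comp_apply Ft ⟨q, hq.continuous⟩ rfl hy₀,
      ← Literature.AlgebraicTopology.FundamentalGroup.mapOfEq_rfl_apply f]
    exact mapOfEq_congr_fun hcomp _ _ γ

omit [T2Space M] [CompactSpace N] in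
/-- **The maximal unramified factorisation `F = q ∘ F̃`** of a non-constant holomorphic map of compact connected
Riemann surfaces: with `H = F_* π₁(M, x₀) ≤ π₁(N, F x₀)` there are a compact connected Riemann surface `Y` (in the
universe of `N`), a holomorphic covering map `q : Y → N` with `[π₁(N, F x₀) : H]` points in every fibre, and a
holomorphic surjective `F̃ : M → Y` with `q ∘ F̃ = F`, `q_* π₁(Y, F̃ x₀) = H` and `F̃_*` onto `π₁(Y, F̃ x₀)`
(Hatcher 1.36 for `H`, the lifting criterion 1.33, Forster 4.6, Farkas–Kra I.1.5).
[cite: HatcherAT2002, §1.3 Prop. 1.33 (p. 61), Prop. 1.36 (p. 68)] [cite: Forster1981, §4 Thm. 4.6]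
[cite: FarkasKra1992, I.1.5 Theorem] -/
theorem exists_unramified_factorisation (hF : MDifferentiable 𝓘(ℂ, ℂ) 𝓘(ℂ, ℂ) F) (hne : ∃ a b, F a ≠ F b)
    (x₀ : M) :
    ∃ (Y : Type v) (_ : TopologicalSpace Y) (_ : ChartedSpace ℂ Y) (_ : IsManifold 𝓘(ℂ, ℂ) ω Y)
      (_ : CompactSpace Y) (_ : T2Space Y) (_ : ConnectedSpace Y) (q : Y → N) (hq : IsCoveringMap q)
      (Ft : C(M, Y)) (hx₀ : q (Ft x₀) = F x₀),
      MDifferentiable 𝓘(ℂ, ℂ) 𝓘(ℂ, ℂ) q ∧ MDifferentiable 𝓘(ℂ, ℂ) 𝓘(ℂ, ℂ) Ft ∧ Surjective Ft ∧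
        (∀ x, q (Ft x) = F x) ∧
        (∀ y, (q ⁻¹' {y}).ncard = (FundamentalGroup.map (⟨F, hF.continuous⟩ : C(M, N)) x₀).range.index) ∧
        (FundamentalGroup.mapOfEq (⟨q, hq.continuous⟩ : C(Y, N)) hx₀).range =
          (FundamentalGroup.map (⟨F, hF.continuous⟩ : C(M, N)) x₀).range ∧
        (FundamentalGroup.map Ft x₀).range = ⊤ := by
  obtain ⟨Y, i1, i2, i3, i4, i5, i6, q, hq, Ft, hx₀, h1, h2, h3, h4, h5, h6, h7, -⟩ :=
    exists_etale_factorisation hF hne x₀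
  exact ⟨Y, i1, i2, i3, i4, i5, i6, q, hq, Ft, hx₀, h1, h2, h3, h4, h5, h6, h7⟩

omit [T2Space M] in
/-- **`F_* π₁(M, x₀)` has finite index in `π₁(N, F x₀)`** for a non-constant holomorphic map of compact connected
Riemann surfaces (the covering of `N` belonging to it is dominated by `M`, hence compact with finitely many
sheets). [cite: HatcherAT2002, §1.3 Prop. 1.33, Prop. 1.36] [cite: FarkasKra1992, I.1.5 Theorem] -/
theorem index_range_map_ne_zero (hF : MDifferentiable 𝓘(ℂ, ℂ) 𝓘(ℂ, ℂ) F) (hne : ∃ a b, F a ≠ F b) (x₀ : M) :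
    (FundamentalGroup.map (⟨F, hF.continuous⟩ : C(M, N)) x₀).range.index ≠ 0 := by
  obtain ⟨Y, _, _, _, _, _, _, q, hq, Ft, hx₀, -, -, -, -, hcard, -, -⟩ := exists_unramified_factorisation hF hne x₀
  rw [← hcard (F x₀)]
  -- the fibre is closed and discrete in the compact `Y`, hence finite and non-empty
  haveI : DiscreteTopology (q ⁻¹' {F x₀}) := (hq (F x₀)).1
  have hc : IsCompact (q ⁻¹' {F x₀}) := (isClosed_singleton.preimage hq.continuous).isCompact
  haveI : Finite (q ⁻¹' {F x₀}) :=
    @finite_of_compact_of_discrete _ _ (isCompact_iff_compactSpace.1 hc) _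
  exact ((Set.ncard_pos (Set.toFinite _)).2 ⟨Ft x₀, hx₀⟩).ne'

omit [T2Space M] in
/-- **`F_* π₁(M, x₀)` is a subgroup of finite index of `π₁(N, F x₀)`.**
[cite: HatcherAT2002, §1.3 Prop. 1.33, Prop. 1.36] [cite: FarkasKra1992, I.1.5 Theorem] -/
theorem finiteIndex_range_map (hF : MDifferentiable 𝓘(ℂ, ℂ) 𝓘(ℂ, ℂ) F) (hne : ∃ a b, F a ≠ F b) (x₀ : M) :
    (FundamentalGroup.map (⟨F, hF.continuous⟩ : C(M, N)) x₀).range.FiniteIndex :=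
  ⟨index_range_map_ne_zero hF hne x₀⟩

/-- **`[π₁(N, F x₀) : F_* π₁(M, x₀)]` divides `deg F`**: `deg F = deg F̃ · deg q` for the unramified factorisation
`F = q ∘ F̃`, and `deg q = [π₁(N) : F_* π₁(M)]` (Farkas–Kra I.1.6: `d` is the total multiplicity of every fibre
of `F`). [cite: HatcherAT2002, §1.3 Prop. 1.32, 1.33, 1.36] [cite: FarkasKra1992, I.1.6 Proposition] -/
theorem index_range_map_dvd_degree (hF : MDifferentiable 𝓘(ℂ, ℂ) 𝓘(ℂ, ℂ) F) (hne : ∃ a b, F a ≠ F b) (x₀ : M)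
    {d : ℕ} (hd : ∀ Q, ∑ᶠ P ∈ F ⁻¹' {Q}, ramificationNumber F P = d) :
    (FundamentalGroup.map (⟨F, hF.continuous⟩ : C(M, N)) x₀).range.index ∣ d := by
  obtain ⟨Y, _, _, _, _, _, _, q, hq, Ft, hx₀, hqd, hFtd, hFts, hqFt, hcard, -, -⟩ :=
    exists_unramified_factorisation hF hne x₀
  haveI := (inferInstance : ConnectedSpace Y).toPreconnectedSpace
  haveI := (inferInstance : ConnectedSpace M).toPreconnectedSpace
  haveI := (inferInstance : ConnectedSpace N).toPreconnectedSpace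
  -- degrees of the factors
  have hFtne : ∃ a b, Ft a ≠ Ft b := by
    obtain ⟨a, b, hab⟩ := hne
    exact ⟨a, b, fun h ↦ hab (by rw [← hqFt a, ← hqFt b, h])⟩
  have hqne : ∃ a b, q a ≠ q b := by
    obtain ⟨a, b, hab⟩ := hne
    exact ⟨Ft a, Ft b, by rwa [hqFt, hqFt]⟩
  obtain ⟨mt, -, hmt⟩ := exists_finsum_ramificationNumber_eq hFtd hFtne
  -- `deg q = [π₁ : H]` (unramified: every fibre counted without multiplicity)
  have hq1 := hq.ramificationNumber_eq_one hqd hqne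
  have hmq : ∀ R, ∑ᶠ Q ∈ q ⁻¹' {R}, ramificationNumber q Q =
      (FundamentalGroup.map (⟨F, hF.continuous⟩ : C(M, N)) x₀).range.index := fun R ↦ by
    rw [← ncard_preimage_singleton_eq_finsum hqd hqne (fun P _ ↦ hq1 P), hcard R]
  have hcomp : ∀ R, ∑ᶠ P ∈ (q ∘ Ft) ⁻¹' {R}, ramificationNumber (q ∘ Ft) P = d := fun R ↦ by
    have : (q ∘ (Ft : M → Y)) = F := funext hqFt
    rw [this]
    exact hd R
  exact ⟨mt, degree_comp_eq_mul hFtd hqd hFtne hqne hmt hmq hcomp⟩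

/-- `[π₁(N, F x₀) : F_* π₁(M, x₀)] ≤ deg F`. [cite: HatcherAT2002, §1.3 Prop. 1.33, 1.36] [cite: FarkasKra1992, I.1.6 Proposition] -/
theorem index_range_map_le_degree (hF : MDifferentiable 𝓘(ℂ, ℂ) 𝓘(ℂ, ℂ) F) (hne : ∃ a b, F a ≠ F b) (x₀ : M)
    {d : ℕ} (hd : ∀ Q, ∑ᶠ P ∈ F ⁻¹' {Q}, ramificationNumber F P = d) :
    (FundamentalGroup.map (⟨F, hF.continuous⟩ : C(M, N)) x₀).range.index ≤ d := by
  obtain ⟨d', hd'pos, hd'⟩ := exists_finsum_ramificationNumber_eq hF hne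
  have hdd : d = d' := by obtain ⟨a, -, -⟩ := hne; rw [← hd (F a), hd' (F a)]
  exact Nat.le_of_dvd (by rw [hdd]; exact hd'pos) (index_range_map_dvd_degree hF hne x₀ hd)

/-- **Prime degree**: if `deg F = p` is prime then either `F_*` is onto `π₁(N, F x₀)` or `F_* π₁(M, x₀)` has index
`p`. [cite: HatcherAT2002, §1.3 Prop. 1.33, 1.36] [cite: FarkasKra1992, I.1.6 Proposition] -/
theorem index_range_map_eq_one_or_eq_of_prime_degree (hF : MDifferentiable 𝓘(ℂ, ℂ) 𝓘(ℂ, ℂ) F)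
    (hne : ∃ a b, F a ≠ F b) (x₀ : M) {p : ℕ} (hp : p.Prime)
    (hd : ∀ Q, ∑ᶠ P ∈ F ⁻¹' {Q}, ramificationNumber F P = p) :
    (FundamentalGroup.map (⟨F, hF.continuous⟩ : C(M, N)) x₀).range.index = 1 ∨
      (FundamentalGroup.map (⟨F, hF.continuous⟩ : C(M, N)) x₀).range.index = p :=
  (Nat.dvd_prime hp).1 (index_range_map_dvd_degree hF hne x₀ hd)

/-- **If `[π₁(N) : F_* π₁(M)] = deg F` then `F` is an unramified covering map** (the factor `F̃` has degree `1`,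
so it is a biholomorphism and `F = q ∘ F̃` is a covering map). [cite: HatcherAT2002, §1.3 Prop. 1.33, 1.36]
[cite: FarkasKra1992, I.1.6 Proposition, I.2.7] -/
theorem isCoveringMap_of_index_eq_degree (hF : MDifferentiable 𝓘(ℂ, ℂ) 𝓘(ℂ, ℂ) F) (hne : ∃ a b, F a ≠ F b)
    (x₀ : M) {d : ℕ} (hd : ∀ Q, ∑ᶠ P ∈ F ⁻¹' {Q}, ramificationNumber F P = d)
    (hidx : (FundamentalGroup.map (⟨F, hF.continuous⟩ : C(M, N)) x₀).range.index = d) :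
    IsCoveringMap F ∧ ∀ P, ramificationNumber F P = 1 := by
  obtain ⟨Y, _, _, _, _, _, _, q, hq, Ft, hx₀, hqd, hFtd, hFts, hqFt, hcard, -, -⟩ :=
    exists_unramified_factorisation hF hne x₀
  haveI := (inferInstance : ConnectedSpace Y).toPreconnectedSpace
  haveI := (inferInstance : ConnectedSpace M).toPreconnectedSpace
  haveI := (inferInstance : ConnectedSpace N).toPreconnectedSpace
  have hFtne : ∃ a b, Ft a ≠ Ft b := by
    obtain ⟨a, b, hab⟩ := hne
    exact ⟨a, b, fun h ↦ hab (by rw [← hqFt a, ← hqFt b, h])⟩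
  have hqne : ∃ a b, q a ≠ q b := by
    obtain ⟨a, b, hab⟩ := hne
    exact ⟨Ft a, Ft b, by rwa [hqFt, hqFt]⟩
  obtain ⟨mt, hmtpos, hmt⟩ := exists_finsum_ramificationNumber_eq hFtd hFtne
  have hq1 := hq.ramificationNumber_eq_one hqd hqne
  have hmq : ∀ R, ∑ᶠ Q ∈ q ⁻¹' {R}, ramificationNumber q Q = d := fun R ↦ by
    rw [← ncard_preimage_singleton_eq_finsum hqd hqne (fun P _ ↦ hq1 P), hcard R, hidx]
  have hcomp : ∀ R, ∑ᶠ P ∈ (q ∘ Ft) ⁻¹' {R}, ramificationNumber (q ∘ Ft) P = d := fun R ↦ by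
    have : (q ∘ (Ft : M → Y)) = F := funext hqFt
    rw [this]
    exact hd R
  have hdeg := degree_comp_eq_mul hFtd hqd hFtne hqne hmt hmq hcomp
  -- `d = d · mt` with `d ≠ 0`, so `mt = 1`: `F̃` is bijective
  have hd0 : d ≠ 0 := by rw [← hidx]; exact index_range_map_ne_zero hF hne x₀
  have hmt1 : mt = 1 := by
    have : d * mt = d * 1 := by rw [mul_one]; exact hdeg.symm
    exact Nat.eq_of_mul_eq_mul_left (Nat.pos_of_ne_zero hd0) this
  subst hmt1
  have hbij : Bijective Ft := bijective_of_finsum_ramificationNumber_eq_one hFtd hFtne hmt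
  obtain ⟨e, he, -⟩ := exists_homeomorph_mdifferentiable_symm hFtd hbij
  have hFeq : F = q ∘ e := by ext x; rw [comp_apply, he, hqFt]
  refine ⟨?_, fun P ↦ ?_⟩
  · rw [hFeq]
    exact hq.comp_homeomorph e
  · -- `n_F(P) = n_q(F̃ P) · n_{F̃}(P) = 1 · 1`
    have h1P : ramificationNumber Ft P = 1 := by
      have hsum := hmt (Ft P)
      have hfib : (Ft : M → Y) ⁻¹' {Ft P} = {P} := by
        ext x
        simp only [mem_preimage, mem_singleton_iff]
        exact ⟨fun h ↦ hbij.1 h, fun h ↦ by rw [h]⟩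
      rw [hfib, finsum_mem_singleton] at hsum
      exact hsum
    have := ramificationNumber_comp (f := (Ft : M → Y)) (g := q) (P := P) (hFtd P).continuousAt
      (Filter.Eventually.of_forall fun y ↦ hFtd y) (hqd (Ft P)).continuousAt
      (Filter.Eventually.of_forall fun y ↦ hqd y)
    rw [show (q ∘ (Ft : M → Y)) = F from funext hqFt, hq1, h1P, mul_one] at this
    exact this

/-- **A ramified holomorphic map of prime degree is onto on `π₁`.** [cite: HatcherAT2002, §1.3 Prop. 1.33, 1.36]
[cite: FarkasKra1992, I.1.6 Proposition, I.2.7] -/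
theorem index_range_map_eq_one_of_prime_of_ramified (hF : MDifferentiable 𝓘(ℂ, ℂ) 𝓘(ℂ, ℂ) F)
    (hne : ∃ a b, F a ≠ F b) (x₀ : M) {p : ℕ} (hp : p.Prime)
    (hd : ∀ Q, ∑ᶠ P ∈ F ⁻¹' {Q}, ramificationNumber F P = p) (hram : ∃ P, ramificationNumber F P ≠ 1) :
    (FundamentalGroup.map (⟨F, hF.continuous⟩ : C(M, N)) x₀).range.index = 1 := by
  rcases index_range_map_eq_one_or_eq_of_prime_degree hF hne x₀ hp hd with h | h
  · exact h
  · obtain ⟨P, hP⟩ := hram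
    exact absurd ((isCoveringMap_of_index_eq_degree hF hne x₀ hd h).2 P) hP

/-- The `π₁`-surjective form: a ramified holomorphic map of prime degree induces a surjection on fundamental
groups. [cite: HatcherAT2002, §1.3 Prop. 1.33, 1.36] [cite: FarkasKra1992, I.1.6 Proposition] -/
theorem surjective_map_of_prime_of_ramified (hF : MDifferentiable 𝓘(ℂ, ℂ) 𝓘(ℂ, ℂ) F)
    (hne : ∃ a b, F a ≠ F b) (x₀ : M) {p : ℕ} (hp : p.Prime)
    (hd : ∀ Q, ∑ᶠ P ∈ F ⁻¹' {Q}, ramificationNumber F P = p) (hram : ∃ P, ramificationNumber F P ≠ 1) :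
    Surjective (FundamentalGroup.map (⟨F, hF.continuous⟩ : C(M, N)) x₀) := by
  rw [← MonoidHom.range_eq_top, ← Subgroup.index_eq_one]
  exact index_range_map_eq_one_of_prime_of_ramified hF hne x₀ hp hd hram

omit [T2Space M] in
/-- **A compact Riemann surface dominated by a simply connected one has trivial fundamental group** (genus `0`):
`F_* π₁(M) = 1` has finite index. [cite: HatcherAT2002, §1.3 Prop. 1.33, 1.36] [cite: FarkasKra1992, I.1.5, IV.6.3] -/
theorem finite_fundamentalGroup_of_simplyConnectedSpace [SimplyConnectedSpace M]
    (hF : MDifferentiable 𝓘(ℂ, ℂ) 𝓘(ℂ, ℂ) F) (hne : ∃ a b, F a ≠ F b) (x₀ : M) :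
    Finite (FundamentalGroup N (F x₀)) := by
  haveI := finiteIndex_range_map hF hne x₀
  have hbot : (FundamentalGroup.map (⟨F, hF.continuous⟩ : C(M, N)) x₀).range = ⊥ := by
    rw [eq_bot_iff]
    rintro _ ⟨γ, rfl⟩
    rw [Subgroup.mem_bot, Subsingleton.elim γ 1, map_one]
  have hidx := index_range_map_ne_zero hF hne x₀
  rw [hbot, Subgroup.index_bot] at hidx
  exact Nat.finite_of_card_ne_zero hidx

omit [T2Space M] in
/-- Hence **a compact Riemann surface holomorphically dominated by a simply connected compact Riemann surface has
genus `0`** (IV.6.3, compact case, via `RiemannSurfaceFiniteFundamentalGroup`).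
[cite: FarkasKra1992, IV.6.3, I.1.5] [cite: HatcherAT2002, §1.3 Prop. 1.33] -/
theorem arithGenus_eq_zero_of_simplyConnectedSpace [SimplyConnectedSpace M]
    (hF : MDifferentiable 𝓘(ℂ, ℂ) 𝓘(ℂ, ℂ) F) (hne : ∃ a b, F a ≠ F b) : arithGenus N = 0 := by
  obtain ⟨a, -, -⟩ := id hne
  haveI := finite_fundamentalGroup_of_simplyConnectedSpace hF hne a
  exact arithGenus_eq_zero_of_finite_fundamentalGroup (F a)

end RiemannSurface

end Literature.Geometry.Kaehler

end
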